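import Literature.NumberTheory.Transcendental.CyclotomicSimplexRep
import Mathlib.LinearAlgebra.Finsupp.LinearCombination
import Mathlib.LinearAlgebra.Span.Defs
import HarnessLib

/-!
# The formal level-4 span: vocabulary for the crux `OctahedralSpanAllWeights` (route `OctahedralSymmetry`)

Route-posited objects (D-0016 `<RouteSlug>Defs`) needed to TYPE the informal crux item
stmt-KontsevichZagierPeriods-9659 (`OctahedralSpanAllWeights`, "the six regularisation-free relation
families reach corank `2^w` in every weight") over the landed word vocabulary
`Literature.NumberTheory.Transcendental.LevelFour.*` (`CyclotomicSimplexRep.lean`, definition request D1 of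
the route). Everything here is finite combinatorics on words; no analysis, no `KZ.relations`.

* `WordQ = List (Fin 5) →₀ ℚ`, the free `ℚ`-module on level-4 words (letters `0..3` = pole `i^m`, `4` =
  pole `0`, outer → inner; `LevelFour.IsConvergent`); `sym W` its basis vector; `toQ` the cast from the
  `ℤ`-combinations produced by the `LevelFour` substitution maps.
* The generators of the COMPLEX form of the families (integer coefficients):
  `invGen W = [W] - sigmaSubst W` (octahedral involution, Zhao 2008 §4), `dilGen W = [W] - dilSubst W` on
  level-2 words (distribution `t ↦ t²`; at weight 1 it is the seed `[−1] − [i] − [−i]`, `log 2 = 2 Re log(1+i)`),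
  `fdsGen k l = stuffleSigned k l − shuffle (word k) (word l)` (finite double shuffle), and the shuffle
  lifts `liftMap u ρ = u ш ρ` (ideal property). `IsGen` is the inductive closure, `rel` its `ℚ`-span.
* SIGN OF THE STUFFLE. With the tree's dictionary `Li(k) = (-1)^{depth k} · I(word k)`
  (`KZ.levelFourRep_value`), the series identity `Li(k) Li(l) = ∑_{m ∈ k ∗ l} Li(m)` reads on words
  `∑_m (-1)^{|k|+|l|+|m|} I(word m) = I(word k) I(word l) = ∑_{u ∈ word k ш word l} I(u)`: the merged terms
  (odd number of merges) enter with a MINUS sign. `stuffleSigned` carries this sign; the unsigned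
  `LevelFour.stuffle` of the tree does not (its docstring's "fds = stuffle − shuffle" is off by these signs:
  e.g. `k = l = (1, −i)` gives `2 I(i,−1) − I(0,−1) − 2 I(i,i) = 0`, whereas the unsigned combination
  evaluates to `2 Li₂(−1) = −π²/6 ≠ 0`; checked numerically to `1e−15` for all pairs of total weight ≤ 4).
* The real form of the informal item (symbols `Re I(W)`, `Im I(W)` plus the conjugation family) has the
  same corank as the complex form: all generators have rational coefficients and the family set is
  conjugation-closed, so the real module modulo (conj) is the Galois-fixed part of `ℚ(i) ⊗ (WordQ / rel)`.
  The typed crux below is therefore stated in the complex (word) form.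
* `SpanBound w` ("corank ≤ 2^w at weight w": the images of at most `2^w` words span the weight-`w`
  quotient), `OctahedralSpanAllWeights = ∀ w, SpanBound w` — the UPPER-BOUND half of the informal
  "reach corank exactly 2^w"; the matching lower bound is Deligne's motivic dimension `d(w,4) = 2^w`
  together with the motivic nature of the families, and is not a statement about this formal module's
  generators that the route needs (the sector consumes only "every motivic relation lies in the span").
* `twoWords w` (the `2^w` words over the poles `±i`), `twoSpan`, `TwoLetterNormalForm w` (every
  convergent word of weight `w` is, modulo `rel`, a `ℚ`-combination of `{i,−i}`-words — the conjectural
  free basis, verified by exact rank computations for `w ≤ 6` in the filing sessions of the route and of the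
  crux idea cards), and `lowerSpan W` (words with fewer letters `e₁`, the unit-pole filtration of card
  `unit-pole-elimination`).

References: J. Zhao, *Standard relations of multiple polylogarithm values at roots of unity*, Doc. Math.
15 (2010), arXiv:0707.1459, §2 (words, shuffle, stuffle, FDS), §5 (distribution); J. Zhao, *Multiple
polylogarithm values at roots of unity*, C. R. Acad. Sci. Paris 346 (2008), arXiv:0810.1064, §4 (the
octahedral involution `σ`); P. Deligne, *Le groupe fondamental unipotent motivique de `𝔾_m − μ_N` pour
`N = 2, 3, 4, 6 ou 8`*, Publ. IHÉS 112 (2010) (`d(w,4) = 2^w`); M. Kontsevich, D. Zagier, *Periods* (2001).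
-/

noncomputable section

namespace Summit.KontsevichZagierPeriods.OctahedralSymmetry.OctaSpan

open Literature.NumberTheory.Transcendental Literature.NumberTheory.Transcendental.LevelFour

/-- The free `ℚ`-module on level-4 words `List (Fin 5)` (all words; statements restrict to convergent
words of a given length). [folklore] -/
abbrev WordQ : Type := List (Fin 5) →₀ ℚ

/-- The basis vector `[W]` of a word. [folklore] -/
def sym (W : List (Fin 5)) : WordQ := Finsupp.single W 1

/-- Cast of an integral formal combination of words (the output type of the `LevelFour` substitution
maps) to `WordQ`. [folklore] -/
def toQ : (List (Fin 5) →₀ ℤ) →+ WordQ := Finsupp.mapRange.addMonoidHom (Int.castAddHom ℚ)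

/-- Coefficients of `toQ x` are the casts of those of `x`. [folklore] -/
@[simp] theorem toQ_apply (x : List (Fin 5) →₀ ℤ) (W : List (Fin 5)) : toQ x W = (x W : ℚ) := rfl

/-- `toQ [W] = [W]`. [folklore] -/
@[simp] theorem toQ_single (W : List (Fin 5)) (c : ℤ) : toQ (Finsupp.single W c) = c • sym W := by
  ext V; by_cases h : W = V <;> simp [sym, h]

/-- **The signed stuffle on words**: `∑_{m ∈ k ∗ l} (-1)^{|k|+|l|+|m|} [word m]` — the level-4 harmonic
product `LevelFour.stuffleIdx` (Zhao 2010, Def. 2.4) transported to words through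
`Li(k) = (-1)^{depth} I(word k)`, so that `I(word k) · I(word l) = ∑ (signed terms)` for convergent
indices. [cite: Zhao2010, §2 Def. 2.4] -/
def stuffleSigned (k l : List (ℕ × Fin 4)) : List (Fin 5) →₀ ℤ :=
  ofTerms ((stuffleIdx k l).map fun m => ((-1 : ℤ) ^ (k.length + l.length + m.length), word m))

/-- **Finite double shuffle generator** `fds(k, l) = stuffleSigned k l − word k ш word l` (both products
of two convergent MPVs expanded; Zhao 2010 §2 (FDS), Racinet 2002 §2). [cite: Zhao2010, §2] -/
def fdsGen (k l : List (ℕ × Fin 4)) : WordQ :=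
  toQ (stuffleSigned k l) - toQ (shuffle (word k) (word l))

/-- **Octahedral involution generator** `[W] − sigmaSubst W` (`I(W) = I(σ^*W)` for the self-map
`σ(t) = (1−t)/(1+t)` of the path; Zhao 2008 §4). [cite: Zhao2008, §4] -/
def invGen (W : List (Fin 5)) : WordQ := sym W - toQ (sigmaSubst W)

/-- **Distribution generator** `[W] − dilSubst W` (`t ↦ t²` on a level-2 word; at weight one the seed
`[−1] − [i] − [−i]`). [cite: Zhao2010, §5] -/
def dilGen (W : List (Fin 5)) : WordQ := sym W - toQ (dilSubst W)

/-- A word is a LEVEL-2 word if its poles lie in `{1, −1, 0}` (letters `0`, `2`, `4`), the domain of the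
squaring substitution (Zhao 2010, §5). -/
def IsLevelTwo (W : List (Fin 5)) : Prop := ∀ a ∈ W, a = 0 ∨ a = 2 ∨ a = 4

/-- `IsLevelTwo` is decidable. [folklore] -/
instance (W : List (Fin 5)) : Decidable (IsLevelTwo W) := by
  unfold IsLevelTwo; infer_instance

/-- **Shuffle lift** by a word `u`: the `ℚ`-linear map `[V] ↦ u ш V` (products of relations with words:
the relation module is a shuffle ideal). [cite: Zhao2010, §2 Lemma 2.2] -/
def liftMap (u : List (Fin 5)) : WordQ →ₗ[ℚ] WordQ :=
  Finsupp.linearCombination ℚ fun V => toQ (shuffle u V)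

/-- **The generators of the regularisation-free level-4 relation module** (complex word form of the six
families of the crux `OctahedralSpanAllWeights`: involution, finite double shuffle, distribution with the
weight-one seed, and shuffle lifts; the conjugation family is absorbed by the complex form;
Zhao 2010 §2, §5, Zhao 2008 §4). -/
inductive IsGen : WordQ → Prop
  | inv {W : List (Fin 5)} (hW : IsConvergent W) : IsGen (invGen W)
  | fds {k l : List (ℕ × Fin 4)} (hk : IsConvergentIdx k) (hl : IsConvergentIdx l) : IsGen (fdsGen k l)
  | dil {W : List (Fin 5)} (hW : IsConvergent W) (h2 : IsLevelTwo W) : IsGen (dilGen W)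
  | lift {u : List (Fin 5)} {ρ : WordQ} (hu : IsConvergent u) (hρ : IsGen ρ) : IsGen (liftMap u ρ)

/-- **The relation module** `rel`: the `ℚ`-span of the generators `IsGen`. [cite: Zhao2010, §2] -/
def rel : Submodule ℚ WordQ := Submodule.span ℚ {ρ | IsGen ρ}

/-- A generator lies in `rel`. [folklore] -/
theorem mem_rel_of_isGen {ρ : WordQ} (h : IsGen ρ) : ρ ∈ rel := Submodule.subset_span h

/-- **The `2^w` two-letter words** of length `w` over the poles `i`, `−i` (letters `1`, `3`): the
conjectural free basis of the quotient. [folklore] -/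
def twoWords : ℕ → Finset (List (Fin 5))
  | 0 => {[]}
  | w + 1 => (twoWords w).biUnion fun V => {(1 : Fin 5) :: V, 3 :: V}

/-- `#twoWords w ≤ 2^w`. [folklore] -/
theorem card_twoWords_le (w : ℕ) : (twoWords w).card ≤ 2 ^ w := by
  induction w with
  | zero => simp [twoWords]
  | succ w ih =>
    calc (twoWords (w + 1)).card ≤ ∑ V ∈ twoWords w, ({(1 : Fin 5) :: V, 3 :: V} : Finset _).card :=
          Finset.card_biUnion_le
      _ ≤ ∑ _V ∈ twoWords w, 2 := Finset.sum_le_sum fun V _ => Finset.card_le_two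
      _ = 2 * (twoWords w).card := by rw [Finset.sum_const, smul_eq_mul, mul_comm]
      _ ≤ 2 ^ (w + 1) := by rw [pow_succ']; exact Nat.mul_le_mul_left 2 ih

/-- Membership in `twoWords`: exactly the words of length `w` all of whose letters are `1` or `3`.
[folklore] -/
theorem mem_twoWords_iff (w : ℕ) (V : List (Fin 5)) :
    V ∈ twoWords w ↔ V.length = w ∧ ∀ a ∈ V, a = 1 ∨ a = 3 := by
  induction w generalizing V with
  | zero =>
    cases V with
    | nil => simp [twoWords]
    | cons a V => simp [twoWords]
  | succ w ih =>
    cases V with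
    | nil => simp [twoWords]
    | cons a V =>
      simp only [twoWords, Finset.mem_biUnion, Finset.mem_insert, Finset.mem_singleton, List.cons.injEq,
        List.length_cons, Nat.add_right_cancel_iff, List.mem_cons, forall_eq_or_imp]
      constructor
      · rintro ⟨U, hU, ⟨ha, hVU⟩ | ⟨ha, hVU⟩⟩
        · rw [hVU]; exact ⟨((ih U).1 hU).1, Or.inl ha, ((ih U).1 hU).2⟩
        · rw [hVU]; exact ⟨((ih U).1 hU).1, Or.inr ha, ((ih U).1 hU).2⟩
      · rintro ⟨hlen, ha, hV⟩
        refine ⟨V, (ih V).2 ⟨hlen, hV⟩, ?_⟩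
        rcases ha with rfl | rfl
        · exact Or.inl ⟨rfl, rfl⟩
        · exact Or.inr ⟨rfl, rfl⟩

/-- The span of the two-letter words of length `w`. [folklore] -/
def twoSpan (w : ℕ) : Submodule ℚ WordQ := Submodule.span ℚ (sym '' ↑(twoWords w))

/-- The span of the convergent words of the same length as `W` with FEWER letters `0` (pole `1`, the form
`dt/(t−1)`): the unit-pole filtration. [folklore] -/
def lowerSpan (W : List (Fin 5)) : Submodule ℚ WordQ :=
  Submodule.span ℚ (sym '' {V | V.length = W.length ∧ IsConvergent V ∧ V.count 0 < W.count 0})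

/-- **`SpanBound w`** — "the families reach corank `≤ 2^w` at weight `w`": the images of at most `2^w`
words span the convergent words of length `w` modulo `rel` (the bound is Deligne's `d(w,4) = 2^w`,
Deligne 2010). -/
def SpanBound (w : ℕ) : Prop :=
  ∃ S : Finset (List (Fin 5)), S.card ≤ 2 ^ w ∧
    ∀ W : List (Fin 5), W.length = w → IsConvergent W → sym W ∈ rel ⊔ Submodule.span ℚ (sym '' ↑S)

/-- **Typed form of the crux `OctahedralSpanAllWeights`** (item stmt-KontsevichZagierPeriods-9659 of route
`OctahedralSymmetry`, informal at filing; typed by the line lead over D1): for every weight `w` the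
regularisation-free families (involution, finite double shuffle, distribution + seed, lifts; conjugation
being automatic in the complex form) cut the formal module of convergent level-4 words of weight `w`
down to dimension `≤ 2^w` (Deligne's `d(w,4)`, Deligne 2010). Computed for `w ≤ 6` (coranks 4, 8, 16,
32, 64); open in general — this is the CONJECTURE raised by the route's computation, not a published result. -/
def OctahedralSpanAllWeights : Prop := ∀ w : ℕ, SpanBound w

/-- **`TwoLetterNormalForm w`** (the line's transfer statement C⁺ at weight `w`): every convergent word
of length `w` is, modulo `rel`, a `ℚ`-combination of the `2^w` words over the poles `±i`. It implies
`SpanBound w`; the rank computations give equality (the two-letter words are a basis) for `w ≤ 6`;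
conjectural in general. -/
def TwoLetterNormalForm (w : ℕ) : Prop :=
  ∀ W : List (Fin 5), W.length = w → IsConvergent W → sym W ∈ rel ⊔ twoSpan w

/-- `TwoLetterNormalForm w → SpanBound w` (take `S = twoWords w`). [folklore] -/
theorem spanBound_of_twoLetterNormalForm {w : ℕ} (h : TwoLetterNormalForm w) : SpanBound w :=
  ⟨twoWords w, card_twoWords_le w, h⟩

end Summit.KontsevichZagierPeriods.OctahedralSymmetry.OctaSpan

end
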